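import Summits.QuantumFields.YangMills.Theorems.LuscherReductionTwistedTraceScalingBOStiffFlatPoincareSelfNorm
import HarnessLib

/-!
# (B-ST) ★★★ THE FLAT MODEL — pullback-ready `hflat` on Lebesgue measure of `ℝ^σ × E` for the weighted ball, the gauge Gaussian window and the Mehler pair
# (lane A of S-BASE, crux `TwistedTraceScaling` stmt-QuantumFields-20203, C4-CORE, the (B-ST) pen; hand C `…-w3`; lead g22 INBOX 22:50:30Z «PLAN TO CLOSE hflat», file (2) `…BOStiffFlatModel`)

The lead's ✓`…BOStiffFlatCoords.flatMap β : (σ_β → ℝ) × ↥(gaugeModes L) →ₗ Bal` (stiff eigenframe of `(β/2)H`, Mehler-normalised, `γ_i = √(π/c_i)`) pulls the door data back to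
`X = ℝ^σ × E` (`E` a finite-dimensional real inner-product space with its Lebesgue measure): `cD∘flatMap ∝ h₀(y)²·e^{−‖z‖²/s²}`, `‖x̂‖² = Σγ_i²y_i² + ‖z‖²`, so the support is the
WEIGHTED BALL `S = {Σ_k γ_k²y_k² + ‖z‖² ≤ r²}`.  This file states ✓`flat_poincare_selfNormalised` / ✓`flat_poincare_betaFree` for exactly these objects against PLAIN LEBESGUE measure on `X`
(all five integrals as set integrals over `S`; the window product measure `dy|_{[−R,R]^σ} ⊗ dz|_{‖z‖≤r}` coincides with Lebesgue on `S ⊆ [−R,R]^σ × {‖z‖ ≤ r}`), with the side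
conditions DISCHARGED: `S` measurable (`measurableSet_weightedBall`), `S ⊆ [−R,R]^σ × {‖z‖≤r}` for `r ≤ γ_kR` (`weightedBall_subset`), `0 < vol S < ∞` and `0 < ∫_S D` (`weightedBall_mass`, the
sup-ball `‖p‖ ≤ r/√(Σγ²+1)` lies in `S`), core stability (✓`coreStable_weightedBall`), the gauge window data (`gaugeGaussian_data`).
* ★★★ `flat_model_selfNormalised` — `J₀ = G·Z/I`, `G = h₀Kh₀' ⊗ e^{−‖z‖²/s²}e^{−‖z'‖²/s²}` UNNORMALISED, `Z = ∫_S D`, `I = ∫_S∫_S G`; `P₀ = 2/(1−ρ)`, `δ = P₀(ε_S + ε_R)`;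
* ★★★ `flat_model` — the same with the normalised kernel `(h₀Kh₀/λ₀)·(D_ZD_Z'/M')`, `M' = ∫_{‖z‖≤r} e^{−‖z‖²/s²}` (window mass).
β-free abstract data only: `(a, b, ρ)`, `γ`, `r ≤ γ_kR`, `s`, `(t,u)` with `(ρr + t√Σγ²)² + u² ≤ r²`, `ε_R = 2n·e^{−π(1−ρ)²R²} ≤ 1/4`, `ε_S = 2n·e^{−πt²} + (∫_{u<‖z‖≤r}e^{−‖z‖²/s²})/(∫_{‖z‖≤r}e^{−‖z‖²/s²}) ≤ 1/4`.
What the bridge (lead, `…BOStiffFlatBridge`) adds: `E := ↥(gaugeModes L)`, the dictionary of ✓`…BOStiffFlatCoords`, the kernel comparison `cΘcKcΘ' ≥ e^{−o(1)}G∘flatMap⁻¹/2^{n/2}` on `cS×cS`,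
✓`hflat_map_of_pullback` and ✓`hflat_transport_cS_map`.
HONEST FRAMING: classical Dirichlet-form bookkeeping for a stub of a child of the CONDITIONAL route R2b1; (B-ST) OPEN; C4-CORE OPEN; not infinite volume, not a gap, not Clay.

## References
* A. Wipf, *Statistical Approach to Quantum Field Theory*, LNP 992, Springer 2021, §8.5.1 (8.56)–(8.58). [Wipf2021]
* M. Fukushima, Y. Oshima, M. Takeda, *Dirichlet Forms and Symmetric Markov Processes*, de Gruyter 2011, §4.4. [FukushimaOshimaTakeda2011]
-/

set_option autoImplicit false

noncomputable section

open MeasureTheory Filter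
open scoped Real

namespace Summit.QuantumFields.YangMills.Theorems.FemtoTransferGap.Mehler

open Literature.Analysis.SegalBargmann

section Model

open StiffDoor Summit.QuantumFields.YangMills.Theorems.TwistedTraceScaling.Negative.R63

variable {σ : Type*} [Fintype σ] [DecidableEq σ]
variable {E : Type*} [NormedAddCommGroup E] [InnerProductSpace ℝ E] [FiniteDimensional ℝ E] [MeasurableSpace E] [BorelSpace E]

/-! ## §1 The weighted ball `S = {Σ_k γ_k²y_k² + ‖z‖² ≤ r²}` (chart image of the support `cS`) and the gauge Gaussian -/

omit [DecidableEq σ] in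
/-- The weighted ball is closed, hence measurable. [folklore] -/
theorem measurableSet_weightedBall (γ : σ → ℝ) (r : ℝ) : MeasurableSet {p : (σ → ℝ) × E | ∑ k, γ k ^ 2 * p.1 k ^ 2 + ‖p.2‖ ^ 2 ≤ r ^ 2} := by
  refine (isClosed_le ?_ continuous_const).measurableSet
  exact (continuous_finsetSum _ fun k _ => continuous_const.mul (((continuous_apply k).comp continuous_fst).pow 2)).add
    ((continuous_norm.comp continuous_snd).pow 2)

omit [Fintype σ] [DecidableEq σ] [InnerProductSpace ℝ E] [FiniteDimensional ℝ E] [MeasurableSpace E] [BorelSpace E] in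
/-- `y² ≤ R²`, `0 ≤ R` ⇒ `|y| ≤ R`. [folklore] -/
theorem abs_le_of_sq_le_sq_aux {y R : ℝ} (hR : 0 ≤ R) (h : y ^ 2 ≤ R ^ 2) : |y| ≤ R :=
  (pow_le_pow_iff_left₀ (abs_nonneg y) hR two_ne_zero).1 (by rwa [sq_abs])

omit [DecidableEq σ] [InnerProductSpace ℝ E] [FiniteDimensional ℝ E] [MeasurableSpace E] [BorelSpace E] in
/-- The weighted ball lies in the box `[−R,R]^σ` times the ball of radius `r` (`r ≤ γ_k R`). [folklore] -/
theorem weightedBall_subset {γ : σ → ℝ} (hγ : ∀ k, 0 < γ k) {r R : ℝ} (hr : 0 < r) (hRr : ∀ k, r ≤ γ k * R) :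
    {p : (σ → ℝ) × E | ∑ k, γ k ^ 2 * p.1 k ^ 2 + ‖p.2‖ ^ 2 ≤ r ^ 2} ⊆ {y : σ → ℝ | ∀ k, |y k - 0| ≤ R} ×ˢ Metric.closedBall (0 : E) r := by
  intro p hp
  rw [Set.mem_setOf_eq] at hp
  have hsum0 : 0 ≤ ∑ k, γ k ^ 2 * p.1 k ^ 2 := Finset.sum_nonneg fun k _ => mul_nonneg (sq_nonneg _) (sq_nonneg _)
  refine ⟨fun k => ?_, ?_⟩
  · have hR : 0 < R := by
      have h : γ k * 0 < γ k * R := by rw [mul_zero]; exact lt_of_lt_of_le hr (hRr k)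
      exact lt_of_mul_lt_mul_left h (hγ k).le
    have h1 : γ k ^ 2 * p.1 k ^ 2 ≤ r ^ 2 :=
      (Finset.single_le_sum (f := fun k => γ k ^ 2 * p.1 k ^ 2) (fun j _ => mul_nonneg (sq_nonneg _) (sq_nonneg _)) (Finset.mem_univ k)).trans
        (by linarith [sq_nonneg ‖p.2‖])
    have h2 : r ^ 2 ≤ γ k ^ 2 * R ^ 2 := by rw [← mul_pow]; exact pow_le_pow_left₀ hr.le (hRr k) 2
    have h3 : p.1 k ^ 2 ≤ R ^ 2 := le_of_mul_le_mul_left (h1.trans h2) (pow_pos (hγ k) 2)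
    rw [sub_zero]; exact abs_le_of_sq_le_sq_aux hR.le h3
  · rw [Metric.mem_closedBall, dist_zero_right]
    exact (pow_le_pow_iff_left₀ (norm_nonneg _) hr.le two_ne_zero).1 (by linarith)

omit [DecidableEq σ] [InnerProductSpace ℝ E] [FiniteDimensional ℝ E] [MeasurableSpace E] [BorelSpace E] in
/-- The weighted ball contains the sup-norm ball of radius `r/√(Σγ_k² + 1)`. [folklore] -/
theorem closedBall_subset_weightedBall (γ : σ → ℝ) (r : ℝ) :
    Metric.closedBall (0 : (σ → ℝ) × E) (r / Real.sqrt (∑ k, γ k ^ 2 + 1)) ⊆ {p : (σ → ℝ) × E | ∑ k, γ k ^ 2 * p.1 k ^ 2 + ‖p.2‖ ^ 2 ≤ r ^ 2} := by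
  intro p hp
  rw [Metric.mem_closedBall, dist_zero_right] at hp
  have hW : 0 < ∑ k, γ k ^ 2 + 1 := by positivity
  have h1 : ∀ k, |p.1 k| ≤ r / Real.sqrt (∑ k, γ k ^ 2 + 1) := fun k => by
    have h := norm_le_pi_norm p.1 k
    rw [Real.norm_eq_abs] at h
    exact h.trans ((norm_fst_le p).trans hp)
  have h2 : ‖p.2‖ ≤ r / Real.sqrt (∑ k, γ k ^ 2 + 1) := (norm_snd_le p).trans hp
  rw [Set.mem_setOf_eq]
  have h3 : ∑ k, γ k ^ 2 * p.1 k ^ 2 ≤ (∑ k, γ k ^ 2) * (r / Real.sqrt (∑ k, γ k ^ 2 + 1)) ^ 2 := by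
    rw [Finset.sum_mul]
    refine Finset.sum_le_sum fun k _ => mul_le_mul_of_nonneg_left ?_ (sq_nonneg _)
    rw [← sq_abs]; exact pow_le_pow_left₀ (abs_nonneg _) (h1 k) 2
  have h4 : ‖p.2‖ ^ 2 ≤ (r / Real.sqrt (∑ k, γ k ^ 2 + 1)) ^ 2 := pow_le_pow_left₀ (norm_nonneg _) h2 2
  have h5 : (∑ k, γ k ^ 2 + 1) * (r / Real.sqrt (∑ k, γ k ^ 2 + 1)) ^ 2 = r ^ 2 := by
    rw [div_pow, Real.sq_sqrt hW.le]; field_simp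
  nlinarith [Finset.sum_nonneg (fun k (_ : k ∈ Finset.univ) => sq_nonneg (γ k))]

/-- The weighted ball has finite and positive Lebesgue measure, and the flat weight `D = h₀² ⊗ e^{−‖z‖²/s²}` (measurable, `0 < D ≤ 2^{n/2}`) has positive mass on it. [folklore] -/
theorem weightedBall_mass {γ : σ → ℝ} (hγ : ∀ k, 0 < γ k) {r R : ℝ} (hr : 0 < r) (hRpos : 0 < R) (hRr : ∀ k, r ≤ γ k * R) (s : ℝ) :
    volume {p : (σ → ℝ) × E | ∑ k, γ k ^ 2 * p.1 k ^ 2 + ‖p.2‖ ^ 2 ≤ r ^ 2} < ⊤ ∧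
    0 < volume {p : (σ → ℝ) × E | ∑ k, γ k ^ 2 * p.1 k ^ 2 + ‖p.2‖ ^ 2 ≤ r ^ 2} ∧
    Measurable (fun p : (σ → ℝ) × E => hR 0 p.1 ^ 2 * Real.exp (-(‖p.2‖ ^ 2 / s ^ 2))) ∧
    (∀ p : (σ → ℝ) × E, 0 < hR 0 p.1 ^ 2 * Real.exp (-(‖p.2‖ ^ 2 / s ^ 2))) ∧
    (∀ p : (σ → ℝ) × E, |hR 0 p.1 ^ 2 * Real.exp (-(‖p.2‖ ^ 2 / s ^ 2))| ≤ vacCoef σ ^ 2) ∧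
    0 < ∫ p in {p : (σ → ℝ) × E | ∑ k, γ k ^ 2 * p.1 k ^ 2 + ‖p.2‖ ^ 2 ≤ r ^ 2}, hR 0 p.1 ^ 2 * Real.exp (-(‖p.2‖ ^ 2 / s ^ 2)) := by
  have hsub := weightedBall_subset (E := E) hγ hr hRr
  have hfin : volume {p : (σ → ℝ) × E | ∑ k, γ k ^ 2 * p.1 k ^ 2 + ‖p.2‖ ^ 2 ≤ r ^ 2} < ⊤ := by
    refine (measure_mono hsub).trans_lt ?_
    rw [Measure.volume_eq_prod, Measure.prod_prod]
    exact ENNReal.mul_lt_top (volume_box (fun _ : σ => (0 : ℝ)) hRpos).1 measure_closedBall_lt_top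
  have hpos : 0 < volume {p : (σ → ℝ) × E | ∑ k, γ k ^ 2 * p.1 k ^ 2 + ‖p.2‖ ^ 2 ≤ r ^ 2} := by
    have hδ : 0 < r / Real.sqrt (∑ k, γ k ^ 2 + 1) := div_pos hr (Real.sqrt_pos.2 (by positivity))
    have hball : 0 < volume (Metric.closedBall (0 : (σ → ℝ) × E) (r / Real.sqrt (∑ k, γ k ^ 2 + 1))) := by
      rw [Measure.volume_eq_prod]
      exact Metric.measure_closedBall_pos _ _ hδ
    exact hball.trans_le (measure_mono (closedBall_subset_weightedBall γ r))
  have hDm : Measurable (fun p : (σ → ℝ) × E => hR 0 p.1 ^ 2 * Real.exp (-(‖p.2‖ ^ 2 / s ^ 2))) :=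
    (((continuous_hR_zero.comp continuous_fst).pow 2).mul
      (Real.continuous_exp.comp (((continuous_norm.comp continuous_snd).pow 2).div_const _).neg)).measurable
  have hDpos : ∀ p : (σ → ℝ) × E, 0 < hR 0 p.1 ^ 2 * Real.exp (-(‖p.2‖ ^ 2 / s ^ 2)) := fun p =>
    mul_pos (pow_pos (hR_zero_pos_le p.1).1 2) (Real.exp_pos _)
  have hDb : ∀ p : (σ → ℝ) × E, |hR 0 p.1 ^ 2 * Real.exp (-(‖p.2‖ ^ 2 / s ^ 2))| ≤ vacCoef σ ^ 2 := fun p => by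
    rw [abs_of_pos (hDpos p)]
    have h1 : hR 0 p.1 ^ 2 ≤ vacCoef σ ^ 2 := pow_le_pow_left₀ (hR_zero_pos_le p.1).1.le (hR_zero_pos_le p.1).2 2
    have h2 : Real.exp (-(‖p.2‖ ^ 2 / s ^ 2)) ≤ 1 := Real.exp_le_one_iff.2 (neg_nonpos.2 (by positivity))
    calc hR 0 p.1 ^ 2 * Real.exp (-(‖p.2‖ ^ 2 / s ^ 2)) ≤ vacCoef σ ^ 2 * 1 := mul_le_mul h1 h2 (Real.exp_pos _).le (sq_nonneg _)
      _ = vacCoef σ ^ 2 := mul_one _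
  refine ⟨hfin, hpos, hDm, hDpos, hDb, ?_⟩
  haveI : IsFiniteMeasure ((volume : Measure ((σ → ℝ) × E)).restrict {p : (σ → ℝ) × E | ∑ k, γ k ^ 2 * p.1 k ^ 2 + ‖p.2‖ ^ 2 ≤ r ^ 2}) :=
    isFiniteMeasure_restrict.2 hfin.ne
  rw [integral_pos_iff_support_of_nonneg_ae (ae_of_all _ fun p => (hDpos p).le) (integrable_of_measurable_abs_le _ hDm hDb)]
  have hsupp : Function.support (fun p : (σ → ℝ) × E => hR 0 p.1 ^ 2 * Real.exp (-(‖p.2‖ ^ 2 / s ^ 2))) = Set.univ :=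
    Set.eq_univ_of_forall fun p => by rw [Function.mem_support]; exact (hDpos p).ne'
  rw [hsupp, Measure.restrict_apply_univ]
  exact hpos

omit [DecidableEq σ] in
/-- The gauge Gaussian `e^{−‖z‖²/s²}` on the window `‖z‖ ≤ r`: measurable, `0 ≤ · ≤ 1`, positive window mass, finite window. [folklore] -/
theorem gaugeGaussian_data (s : ℝ) {r : ℝ} (hr : 0 < r) :
    Measurable (fun z : E => Real.exp (-(‖z‖ ^ 2 / s ^ 2))) ∧ (∀ z : E, |Real.exp (-(‖z‖ ^ 2 / s ^ 2))| ≤ 1) ∧ (∀ z : E, 0 ≤ Real.exp (-(‖z‖ ^ 2 / s ^ 2))) ∧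
    volume (Metric.closedBall (0 : E) r) < ⊤ ∧ 0 < ∫ z in Metric.closedBall (0 : E) r, Real.exp (-(‖z‖ ^ 2 / s ^ 2)) := by
  have hm : Measurable (fun z : E => Real.exp (-(‖z‖ ^ 2 / s ^ 2))) := (Real.continuous_exp.comp ((continuous_norm.pow 2).div_const _).neg).measurable
  have hb : ∀ z : E, |Real.exp (-(‖z‖ ^ 2 / s ^ 2))| ≤ 1 := fun z => by
    rw [abs_of_pos (Real.exp_pos _)]; exact Real.exp_le_one_iff.2 (neg_nonpos.2 (by positivity))
  have hfin : volume (Metric.closedBall (0 : E) r) < ⊤ := measure_closedBall_lt_top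
  refine ⟨hm, hb, fun z => (Real.exp_pos _).le, hfin, ?_⟩
  haveI : IsFiniteMeasure ((volume : Measure E).restrict (Metric.closedBall (0 : E) r)) := isFiniteMeasure_restrict.2 hfin.ne
  rw [integral_pos_iff_support_of_nonneg_ae (ae_of_all _ fun z => (Real.exp_pos _).le) (integrable_of_measurable_abs_le _ hm hb)]
  have hsupp : Function.support (fun z : E => Real.exp (-(‖z‖ ^ 2 / s ^ 2))) = Set.univ :=
    Set.eq_univ_of_forall fun z => by rw [Function.mem_support]; exact (Real.exp_pos _).ne'
  rw [hsupp, Measure.restrict_apply_univ]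
  exact Metric.measure_closedBall_pos _ _ hr

/-! ## §2 ★★★ The flat model inequalities on Lebesgue measure of `ℝ^σ × E` -/

/-- ★★★ **FLAT MODEL, SELF-NORMALISED** (pullback-ready; lead g22 INBOX 22:50:30Z, file (2)).  β-free abstract data: Mehler `a, b` (`a_k² + 2a_kb_k = π²`), contraction
`b_k/s_k ≤ ρ < 1`; weights `γ_k > 0`; radii `0 < r ≤ γ_k R`; gauge width `s`; core scales `t, u ≥ 0` with `(ρr + t√(Σγ_k²))² + u² ≤ r²`; smallness `ε_R = 2n·e^{−π(1−ρ)²R²} ≤ 1/4`,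
`ε_S = 2n·e^{−πt²} + (∫_{u<‖z‖≤r}e^{−‖z‖²/s²})/(∫_{‖z‖≤r}e^{−‖z‖²/s²}) ≤ 1/4`.  OBJECTS on `X = ℝ^σ × E` with LEBESGUE measure: `S = {Σγ_k²y_k² + ‖z‖² ≤ r²}`,
`D(y,z) = h₀(y)²·e^{−‖z‖²/s²}`, `G((y,z),(y',z')) = h₀(y)K(y,y')h₀(y')·e^{−‖z‖²/s²}e^{−‖z'‖²/s²}`, `Z = ∫_S D`, `I = ∫_S∫_S G`.  THEN for every bounded measurable `g` vanishing off `S`: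
`∫_S g²D − (∫_S gD)²/∫_S D ≤ (2/(1−ρ))·½∫_S∫_S (g(p)−g(q))²·G(p,q)·(Z/I) + (2/(1−ρ))(ε_S + ε_R)·∫_S g²D`. [cite: Wipf2021, §8.5.1 (8.58)] [cite: FukushimaOshimaTakeda2011, §4.4] -/
theorem flat_model_selfNormalised {a b : σ → ℝ} (ha : ∀ k, 0 < a k) (hb : ∀ k, 0 < b k) (hab : ∀ k, a k ^ 2 + 2 * a k * b k = π ^ 2)
    {ρ : ℝ} (hρ0 : 0 ≤ ρ) (hρ : ∀ k, b k / (a k + b k + π) ≤ ρ) (hρ1 : ρ < 1)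
    {γ : σ → ℝ} (hγ : ∀ k, 0 < γ k) {r R : ℝ} (hr : 0 < r) (hRpos : 0 < R) (hRr : ∀ k, r ≤ γ k * R) (s : ℝ)
    {t u : ℝ} (ht : 0 ≤ t) (hfit : (ρ * r + t * Real.sqrt (∑ k, γ k ^ 2)) ^ 2 + u ^ 2 ≤ r ^ 2)
    (hεR : 2 * Fintype.card σ * Real.exp (-(π * ((1 - ρ) * R) ^ 2)) ≤ 1 / 4)
    (hεS : 2 * Fintype.card σ * Real.exp (-(π * t ^ 2)) +
      (∫ z in (Metric.closedBall (0 : E) u)ᶜ ∩ Metric.closedBall (0 : E) r, Real.exp (-(‖z‖ ^ 2 / s ^ 2))) /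
        (∫ z in Metric.closedBall (0 : E) r, Real.exp (-(‖z‖ ^ 2 / s ^ 2))) ≤ 1 / 4)
    {g : (σ → ℝ) × E → ℝ} (hg : Measurable g) {Cg : ℝ} (hgb : ∀ p, |g p| ≤ Cg)
    (hgS : ∀ p, p ∉ {p : (σ → ℝ) × E | ∑ k, γ k ^ 2 * p.1 k ^ 2 + ‖p.2‖ ^ 2 ≤ r ^ 2} → g p = 0) :
    (∫ p in {p : (σ → ℝ) × E | ∑ k, γ k ^ 2 * p.1 k ^ 2 + ‖p.2‖ ^ 2 ≤ r ^ 2}, g p ^ 2 * (hR 0 p.1 ^ 2 * Real.exp (-(‖p.2‖ ^ 2 / s ^ 2)))) -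
        (∫ p in {p : (σ → ℝ) × E | ∑ k, γ k ^ 2 * p.1 k ^ 2 + ‖p.2‖ ^ 2 ≤ r ^ 2}, g p * (hR 0 p.1 ^ 2 * Real.exp (-(‖p.2‖ ^ 2 / s ^ 2)))) ^ 2 /
          (∫ p in {p : (σ → ℝ) × E | ∑ k, γ k ^ 2 * p.1 k ^ 2 + ‖p.2‖ ^ 2 ≤ r ^ 2}, hR 0 p.1 ^ 2 * Real.exp (-(‖p.2‖ ^ 2 / s ^ 2))) ≤
      2 / (1 - ρ) * ((1 / 2) * ∫ p in {p : (σ → ℝ) × E | ∑ k, γ k ^ 2 * p.1 k ^ 2 + ‖p.2‖ ^ 2 ≤ r ^ 2},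
          ∫ q in {p : (σ → ℝ) × E | ∑ k, γ k ^ 2 * p.1 k ^ 2 + ‖p.2‖ ^ 2 ≤ r ^ 2}, (g p - g q) ^ 2 *
            (hR 0 p.1 * mehlerKernel a b p.1 q.1 * hR 0 q.1 * (Real.exp (-(‖p.2‖ ^ 2 / s ^ 2)) * Real.exp (-(‖q.2‖ ^ 2 / s ^ 2))) *
              ((∫ p in {p : (σ → ℝ) × E | ∑ k, γ k ^ 2 * p.1 k ^ 2 + ‖p.2‖ ^ 2 ≤ r ^ 2}, hR 0 p.1 ^ 2 * Real.exp (-(‖p.2‖ ^ 2 / s ^ 2))) /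
                ∫ p in {p : (σ → ℝ) × E | ∑ k, γ k ^ 2 * p.1 k ^ 2 + ‖p.2‖ ^ 2 ≤ r ^ 2},
                  ∫ q in {p : (σ → ℝ) × E | ∑ k, γ k ^ 2 * p.1 k ^ 2 + ‖p.2‖ ^ 2 ≤ r ^ 2},
                    hR 0 p.1 * mehlerKernel a b p.1 q.1 * hR 0 q.1 * (Real.exp (-(‖p.2‖ ^ 2 / s ^ 2)) * Real.exp (-(‖q.2‖ ^ 2 / s ^ 2)))))) +
        2 / (1 - ρ) * ((2 * Fintype.card σ * Real.exp (-(π * t ^ 2)) +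
              (∫ z in (Metric.closedBall (0 : E) u)ᶜ ∩ Metric.closedBall (0 : E) r, Real.exp (-(‖z‖ ^ 2 / s ^ 2))) /
                ∫ z in Metric.closedBall (0 : E) r, Real.exp (-(‖z‖ ^ 2 / s ^ 2))) +
            2 * Fintype.card σ * Real.exp (-(π * ((1 - ρ) * R) ^ 2))) *
          ∫ p in {p : (σ → ℝ) × E | ∑ k, γ k ^ 2 * p.1 k ^ 2 + ‖p.2‖ ^ 2 ≤ r ^ 2}, g p ^ 2 * (hR 0 p.1 ^ 2 * Real.exp (-(‖p.2‖ ^ 2 / s ^ 2))) := by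
  obtain ⟨hDZm, hDZb, hDZ0, hWfin, hMZ⟩ := gaugeGaussian_data (E := E) s hr
  obtain ⟨-, -, -, -, -, hZS⟩ := weightedBall_mass (E := E) hγ hr hRpos hRr s
  have hS := measurableSet_weightedBall (E := E) γ r
  have hSTW := weightedBall_subset (E := E) hγ hr hRr
  haveI : IsFiniteMeasure ((volume : Measure E).restrict (Metric.closedBall (0 : E) r)) := isFiniteMeasure_restrict.2 hWfin.ne
  -- the two measure identities
  have hν : (((volume : Measure (σ → ℝ)).restrict {y : σ → ℝ | ∀ k, |y k - 0| ≤ R}).prod ((volume : Measure E).restrict (Metric.closedBall (0 : E) r))).restrict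
      {p : (σ → ℝ) × E | ∑ k, γ k ^ 2 * p.1 k ^ 2 + ‖p.2‖ ^ 2 ≤ r ^ 2} =
      (volume : Measure ((σ → ℝ) × E)).restrict {p : (σ → ℝ) × E | ∑ k, γ k ^ 2 * p.1 k ^ 2 + ‖p.2‖ ^ 2 ≤ r ^ 2} := by
    rw [Measure.prod_restrict, ← Measure.volume_eq_prod, Measure.restrict_restrict_of_subset hSTW]
  have hWW : ((volume : Measure E).restrict (Metric.closedBall (0 : E) r)).restrict (Metric.closedBall (0 : E) u)ᶜ =
      (volume : Measure E).restrict ((Metric.closedBall (0 : E) u)ᶜ ∩ Metric.closedBall (0 : E) r) :=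
    Measure.restrict_restrict Metric.isClosed_closedBall.measurableSet.compl
  have hST : ∀ p ∈ {p : (σ → ℝ) × E | ∑ k, γ k ^ 2 * p.1 k ^ 2 + ‖p.2‖ ^ 2 ≤ r ^ 2}, ∀ k, |p.1 k - 0| ≤ R := fun p hp => (hSTW hp).1
  have hMZ' : 0 < ∫ z, Real.exp (-(‖z‖ ^ 2 / s ^ 2)) ∂((volume : Measure E).restrict (Metric.closedBall (0 : E) r)) := hMZ
  have hεS' : 2 * Fintype.card σ * Real.exp (-(π * t ^ 2)) +
      (∫ z in (Metric.closedBall (0 : E) u)ᶜ, Real.exp (-(‖z‖ ^ 2 / s ^ 2)) ∂((volume : Measure E).restrict (Metric.closedBall (0 : E) r))) /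
        ∫ z, Real.exp (-(‖z‖ ^ 2 / s ^ 2)) ∂((volume : Measure E).restrict (Metric.closedBall (0 : E) r)) ≤ 1 / 4 := by
    rw [hWW]; exact hεS
  have hZS' : 0 < ∫ p in {p : (σ → ℝ) × E | ∑ k, γ k ^ 2 * p.1 k ^ 2 + ‖p.2‖ ^ 2 ≤ r ^ 2}, hR 0 p.1 ^ 2 * Real.exp (-(‖p.2‖ ^ 2 / s ^ 2))
      ∂(((volume : Measure (σ → ℝ)).restrict {y : σ → ℝ | ∀ k, |y k - 0| ≤ R}).prod ((volume : Measure E).restrict (Metric.closedBall (0 : E) r))) := by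
    rw [hν]; exact hZS
  have hcore : ∀ p ∈ {p : (σ → ℝ) × E | ∑ k, γ k ^ 2 * p.1 k ^ 2 + ‖p.2‖ ^ 2 ≤ r ^ 2}, ∀ q : (σ → ℝ) × E,
      (∀ k, |q.1 k - b k / (a k + b k + π) * p.1 k| ≤ t) → q.2 ∈ Metric.closedBall (0 : E) u → q ∈ {p : (σ → ℝ) × E | ∑ k, γ k ^ 2 * p.1 k ^ 2 + ‖p.2‖ ^ 2 ≤ r ^ 2} :=
    fun p hp q hq1 hq2 => coreStable_weightedBall (w := fun k => γ k ^ 2) (fun k => sq_nonneg (γ k)) hr.le (ratio_nonneg ha hb) hρ0 hρ ht hfit hp q hq1 hq2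
  have h := flat_poincare_selfNormalised (κ := (volume : Measure E).restrict (Metric.closedBall (0 : E) r)) ha hb hab hρ0 hρ hρ1 hRpos hεR rfl hDZm hDZb hDZ0 hMZ'
    hS hST ht Metric.isClosed_closedBall.measurableSet hcore hεS' hZS' hg hgb hgS
  rw [hν, hWW] at h
  exact h

/-- ★★★ **FLAT MODEL, NORMALISED KERNEL** (same data): with the λ₀- and window-mass-normalised kernel `J₀ = (h₀Kh₀/λ₀)·(D_ZD_Z'/M')`, `M' = ∫_{‖z‖≤r} e^{−‖z‖²/s²}`:
`∫_S g²D − (∫_S gD)²/∫_S D ≤ (2/(1−ρ))·½∫_S∫_S (g(p)−g(q))²J₀ + (2/(1−ρ))(ε_S + ε_R)·∫_S g²D` (here only `ε_R ≤ 1/2` is needed). [cite: Wipf2021, §8.5.1 (8.58)] -/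
theorem flat_model {a b : σ → ℝ} (ha : ∀ k, 0 < a k) (hb : ∀ k, 0 < b k) (hab : ∀ k, a k ^ 2 + 2 * a k * b k = π ^ 2)
    {ρ : ℝ} (hρ0 : 0 ≤ ρ) (hρ : ∀ k, b k / (a k + b k + π) ≤ ρ) (hρ1 : ρ < 1)
    {γ : σ → ℝ} (hγ : ∀ k, 0 < γ k) {r R : ℝ} (hr : 0 < r) (hRpos : 0 < R) (hRr : ∀ k, r ≤ γ k * R) (s : ℝ)
    {t u : ℝ} (ht : 0 ≤ t) (hfit : (ρ * r + t * Real.sqrt (∑ k, γ k ^ 2)) ^ 2 + u ^ 2 ≤ r ^ 2)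
    (hεR : 2 * Fintype.card σ * Real.exp (-(π * ((1 - ρ) * R) ^ 2)) ≤ 1 / 2)
    {g : (σ → ℝ) × E → ℝ} (hg : Measurable g) {Cg : ℝ} (hgb : ∀ p, |g p| ≤ Cg)
    (hgS : ∀ p, p ∉ {p : (σ → ℝ) × E | ∑ k, γ k ^ 2 * p.1 k ^ 2 + ‖p.2‖ ^ 2 ≤ r ^ 2} → g p = 0) :
    (∫ p in {p : (σ → ℝ) × E | ∑ k, γ k ^ 2 * p.1 k ^ 2 + ‖p.2‖ ^ 2 ≤ r ^ 2}, g p ^ 2 * (hR 0 p.1 ^ 2 * Real.exp (-(‖p.2‖ ^ 2 / s ^ 2)))) -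
        (∫ p in {p : (σ → ℝ) × E | ∑ k, γ k ^ 2 * p.1 k ^ 2 + ‖p.2‖ ^ 2 ≤ r ^ 2}, g p * (hR 0 p.1 ^ 2 * Real.exp (-(‖p.2‖ ^ 2 / s ^ 2)))) ^ 2 /
          (∫ p in {p : (σ → ℝ) × E | ∑ k, γ k ^ 2 * p.1 k ^ 2 + ‖p.2‖ ^ 2 ≤ r ^ 2}, hR 0 p.1 ^ 2 * Real.exp (-(‖p.2‖ ^ 2 / s ^ 2))) ≤
      2 / (1 - ρ) * ((1 / 2) * ∫ p in {p : (σ → ℝ) × E | ∑ k, γ k ^ 2 * p.1 k ^ 2 + ‖p.2‖ ^ 2 ≤ r ^ 2},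
          ∫ q in {p : (σ → ℝ) × E | ∑ k, γ k ^ 2 * p.1 k ^ 2 + ‖p.2‖ ^ 2 ≤ r ^ 2}, (g p - g q) ^ 2 *
            ((hR 0 p.1 * mehlerKernel a b p.1 q.1 * hR 0 q.1 / ∏ k, Real.sqrt (π / (a k + b k + π))) *
              (Real.exp (-(‖p.2‖ ^ 2 / s ^ 2)) * Real.exp (-(‖q.2‖ ^ 2 / s ^ 2)) / ∫ z in Metric.closedBall (0 : E) r, Real.exp (-(‖z‖ ^ 2 / s ^ 2))))) +
        2 / (1 - ρ) * ((2 * Fintype.card σ * Real.exp (-(π * t ^ 2)) +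
              (∫ z in (Metric.closedBall (0 : E) u)ᶜ ∩ Metric.closedBall (0 : E) r, Real.exp (-(‖z‖ ^ 2 / s ^ 2))) /
                ∫ z in Metric.closedBall (0 : E) r, Real.exp (-(‖z‖ ^ 2 / s ^ 2))) +
            2 * Fintype.card σ * Real.exp (-(π * ((1 - ρ) * R) ^ 2))) *
          ∫ p in {p : (σ → ℝ) × E | ∑ k, γ k ^ 2 * p.1 k ^ 2 + ‖p.2‖ ^ 2 ≤ r ^ 2}, g p ^ 2 * (hR 0 p.1 ^ 2 * Real.exp (-(‖p.2‖ ^ 2 / s ^ 2))) := by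
  obtain ⟨hDZm, hDZb, hDZ0, hWfin, hMZ⟩ := gaugeGaussian_data (E := E) s hr
  obtain ⟨-, -, -, -, -, hZS⟩ := weightedBall_mass (E := E) hγ hr hRpos hRr s
  have hS := measurableSet_weightedBall (E := E) γ r
  have hSTW := weightedBall_subset (E := E) hγ hr hRr
  haveI : IsFiniteMeasure ((volume : Measure E).restrict (Metric.closedBall (0 : E) r)) := isFiniteMeasure_restrict.2 hWfin.ne
  have hν : (((volume : Measure (σ → ℝ)).restrict {y : σ → ℝ | ∀ k, |y k - 0| ≤ R}).prod ((volume : Measure E).restrict (Metric.closedBall (0 : E) r))).restrict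
      {p : (σ → ℝ) × E | ∑ k, γ k ^ 2 * p.1 k ^ 2 + ‖p.2‖ ^ 2 ≤ r ^ 2} =
      (volume : Measure ((σ → ℝ) × E)).restrict {p : (σ → ℝ) × E | ∑ k, γ k ^ 2 * p.1 k ^ 2 + ‖p.2‖ ^ 2 ≤ r ^ 2} := by
    rw [Measure.prod_restrict, ← Measure.volume_eq_prod, Measure.restrict_restrict_of_subset hSTW]
  have hWW : ((volume : Measure E).restrict (Metric.closedBall (0 : E) r)).restrict (Metric.closedBall (0 : E) u)ᶜ =
      (volume : Measure E).restrict ((Metric.closedBall (0 : E) u)ᶜ ∩ Metric.closedBall (0 : E) r) :=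
    Measure.restrict_restrict Metric.isClosed_closedBall.measurableSet.compl
  have hST : ∀ p ∈ {p : (σ → ℝ) × E | ∑ k, γ k ^ 2 * p.1 k ^ 2 + ‖p.2‖ ^ 2 ≤ r ^ 2}, ∀ k, |p.1 k - 0| ≤ R := fun p hp => (hSTW hp).1
  have hMZ' : 0 < ∫ z, Real.exp (-(‖z‖ ^ 2 / s ^ 2)) ∂((volume : Measure E).restrict (Metric.closedBall (0 : E) r)) := hMZ
  have hZS' : 0 < ∫ p in {p : (σ → ℝ) × E | ∑ k, γ k ^ 2 * p.1 k ^ 2 + ‖p.2‖ ^ 2 ≤ r ^ 2}, hR 0 p.1 ^ 2 * Real.exp (-(‖p.2‖ ^ 2 / s ^ 2))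
      ∂(((volume : Measure (σ → ℝ)).restrict {y : σ → ℝ | ∀ k, |y k - 0| ≤ R}).prod ((volume : Measure E).restrict (Metric.closedBall (0 : E) r))) := by
    rw [hν]; exact hZS
  have hcore : ∀ p ∈ {p : (σ → ℝ) × E | ∑ k, γ k ^ 2 * p.1 k ^ 2 + ‖p.2‖ ^ 2 ≤ r ^ 2}, ∀ q : (σ → ℝ) × E,
      (∀ k, |q.1 k - b k / (a k + b k + π) * p.1 k| ≤ t) → q.2 ∈ Metric.closedBall (0 : E) u → q ∈ {p : (σ → ℝ) × E | ∑ k, γ k ^ 2 * p.1 k ^ 2 + ‖p.2‖ ^ 2 ≤ r ^ 2} :=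
    fun p hp q hq1 hq2 => coreStable_weightedBall (w := fun k => γ k ^ 2) (fun k => sq_nonneg (γ k)) hr.le (ratio_nonneg ha hb) hρ0 hρ ht hfit hp q hq1 hq2
  obtain ⟨-, -, hin, hout⟩ := flatJ0_admissible (Z := E) ha hb hDZm hDZb hDZ0 hMZ' hS
  have h := flat_poincare_betaFree (κ := (volume : Measure E).restrict (Metric.closedBall (0 : E) r)) ha hb hab hρ0 hρ hρ1 hRpos hεR rfl hDZm hDZb hDZ0 hMZ'
    hS hST ht Metric.isClosed_closedBall.measurableSet hcore hZS' hg hgb hgS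
  rw [censoredForm_eq (μ := ((volume : Measure (σ → ℝ)).restrict {y : σ → ℝ | ∀ k, |y k - 0| ≤ R}).prod
    ((volume : Measure E).restrict (Metric.closedBall (0 : E) r))) hin hout hS] at h
  rw [hν, hWW] at h
  exact h

end Model

end Summit.QuantumFields.YangMills.Theorems.FemtoTransferGap.Mehler

end
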